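import Summits.AtomisticToContinuum.FouriersLaw.Theorems.BondHeatUncertaintyLightConeBondHeatTentStatics
import Summits.AtomisticToContinuum.FouriersLaw.Theorems.OddSectorIrreversibilitySubBallisticWindowStaticCurrentBound

/-!
# The `N`-uniform linear (ballistic) ceiling of the bond-heat variance on the light cone

Support file for item `stmt-AtomisticToContinuum-9123` (`BondHeatUncertainty.LightConeBondHeat`, (S_lc): `V_N(b,t) ≤ A√t` on
`1 ≤ t ≤ a·N` for the equilibrium bond-heat variance `V_N(b,t) = 2∫₀ᵗ (t−s) C_N(b,s) ds` of the pinned anharmonic chain).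
This file proves, UNCONDITIONALLY and uniformly in `N`, the exponent-`1` version of the item on the same kind of window:

* `pinnedChain_integral_sq_blockSum_le` — `N`-uniform statics of the block current `J = ∑_{b₀ ≤ k ≤ b₀+L} j_k`:
  `∫ J² dμ_T ≤ C_J (L+1)` for every `N`, `b₀`, `L` (the landed `SubBallisticWindow.StaticCurrentBound.stub_staticCurrentBound`
  fed with the PROVED `N`-uniform Poincaré inequality / moments `stub_gibbsPoincare`, `stub_gibbsMoments`, transported from
  `e^{-H/T} dq dp` to `μ_T`);
* `pinnedChain_blockGK_abs_le` — hence `∫₀ᵗ |K_J(s)| ds ≤ C_J (L+1) t` (`|K_J(s)| ≤ ∫ J² dμ_T`, Jensen + Gibbs invariance of the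
  constructed kernels, `pinnedChain_autocorr_abs_le`);
* `pinnedChain_bondHeatVar_le_linear` — with the tent reduction `pinnedChain_bondHeatVar_le_blockGK`
  (`V_N(b₀,t) ≤ (4t/(L+1)²)∫₀ᵗ|K_J| + 8c(L+1)`) and the tent length `L = ⌊t⌋`:  **`V_N(b₀,t) ≤ B·t`** for every `N`, every
  bond `b₀` with `b₀ + ⌊t⌋ + 1 < N` and every `t ≥ 1`, `B = 4C_J + 16c` independent of `N`, `b₀`, `t`;
* `lightCone_bondHeatVar_le_linear` — in the spelling of the item: `∃ B ∀ N ≥ 3 ∀ t ∈ [1, N/2], V_N(0,t) ≤ B·t`.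

So on the light-cone window the item's functional is `O(t)` uniformly in `N` by conservation + statics alone (the naive size
bound is `2⟨j_b²⟩_T t²`); this is the ballistic value `θ = 1` of the windowed laws `V ≤ B t^θ` — attained by the harmonic member
(`V_∞(t) = 0.390·t` at the bulk bond, crux 9120 `Disproof.lean` §5), and void for the route's transfer
(`…LightConeBondHeatWindowedTransfer` needs `θ < 1`).  The ENTIRE open content of (S_lc) is the improvement `t ↦ √t`, i.e. an
`N`-uniform sublinear bound `∫₀ᵗ |K_J| = o(t)·(L+1)` on the block Green–Kubo integral (dynamical decorrelation of the
deterministic anharmonic bulk; open, BLR2000 §6.3).  Nothing here closes the item.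
-/

noncomputable section

open MeasureTheory Filter Topology Set intervalIntegral
open scoped NNReal ENNReal

namespace Summit.AtomisticToContinuum.FouriersLaw.Theorems.LightConeBondHeat

open Literature.MathematicalPhysics.KineticTheory.HeatConduction
open Literature.MathematicalPhysics.KineticTheory Literature.Probability.Process OscillatorChain
open Summit.AtomisticToContinuum.FouriersLaw.Theorems.SubdiffusiveBondHeat

/-! ### `N`-uniform statics of the block current on `μ_T` -/

/-- **`∫ J² dμ_T ≤ C_J (L+1)` uniformly in `N`, `b₀`, `L`** for the block current `J = ∑_{b₀ ≤ k ≤ b₀+L} j_k` of the pinned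
anharmonic chain (`ω₂ > 0`, `lam, β ≥ 0`, any `γ`, `T > 0`): the landed static block-current bound under the Gibbs WEIGHT
(`stub_staticCurrentBound`, given `N`-uniform coordinate moments, which `stub_gibbsMoments` derives from the PROVED `N`-uniform
Poincaré inequality `stub_gibbsPoincare`), divided by the partition function. [folklore] -/
theorem pinnedChain_integral_sq_blockSum_le {ω₂ lam β : ℝ} (hω : 0 < ω₂) (hl : 0 ≤ lam) (hβ : 0 ≤ β) (γ : ℝ) {T : ℝ}
    (hT : 0 < T) :
    ∃ C : ℝ, 0 ≤ C ∧ ∀ (N b₀ L : ℕ),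
      ∫ z, (∑ k : Fin N, (if b₀ ≤ k.val ∧ k.val ≤ b₀ + L then (pinnedChain ω₂ lam β γ).bondCurrent N k z else 0)) ^ 2
        ∂((pinnedChain ω₂ lam β γ).gibbsMeasure N T) ≤ C * ((L : ℝ) + 1) := by
  have hP := Summit.AtomisticToContinuum.FouriersLaw.Theorems.SubBallisticWindow.GibbsPoincare.stub_gibbsPoincare
    ω₂ lam β γ hω hl hβ T hT
  have hM := fun m : ℕ =>
    Summit.AtomisticToContinuum.FouriersLaw.Theorems.SubBallisticWindow.GibbsMoments.stub_gibbsMoments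
      ω₂ lam β γ hω hl hβ T hT hP m
  obtain ⟨C, hC⟩ :=
    Summit.AtomisticToContinuum.FouriersLaw.Theorems.SubBallisticWindow.StaticCurrentBound.stub_staticCurrentBound
      ω₂ lam β γ hω hl hβ T hT hM
  refine ⟨max C 0, le_max_right _ _, fun N b₀ L => ?_⟩
  set P := pinnedChain ω₂ lam β γ with hPdef
  set μw : Measure (PhaseSpace N) := volume.withDensity fun x : PhaseSpace N =>
    ENNReal.ofReal (Real.exp (-(P.hamiltonian N x) / T)) with hμw
  set Z : ℝ := ∫ x : PhaseSpace N, Real.exp (-(P.hamiltonian N x) / T) with hZ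
  have hρ : Integrable (fun x : PhaseSpace N => Real.exp (-(P.hamiltonian N x) / T)) :=
    pinnedChain_integrable_gibbsDensity hω hl hβ γ N hT
  have hZpos : 0 < Z := integral_exp_pos hρ
  -- the static bound under the Gibbs weight, block `[b₀, b₀ + L + 1)`
  have h := hC N b₀ (b₀ + L + 1) (by omega)
  simp only [Nat.lt_add_one_iff] at h
  have hcast : ((b₀ + L + 1 : ℕ) : ℝ) - (b₀ : ℝ) = (L : ℝ) + 1 := by push_cast; ring
  rw [hcast] at h
  -- normalisation `∫ g dμ_T = Z⁻¹ ∫ g dμw`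
  have hnorm : ∀ g : PhaseSpace N → ℝ, ∫ x, g x ∂(P.gibbsMeasure N T) = Z⁻¹ * ∫ x, g x ∂μw := by
    intro g
    rw [P.integral_gibbsMeasure,
      Summit.AtomisticToContinuum.FouriersLaw.Theorems.SubBallisticWindow.GibbsPoincare.integral_gibbsWeight_eq]
    rfl
  rw [hnorm, inv_mul_le_iff₀ hZpos]
  have hL : (0 : ℝ) ≤ (L : ℝ) + 1 := by positivity
  calc ∫ x, (∑ k : Fin N, (if b₀ ≤ k.val ∧ k.val ≤ b₀ + L then P.bondCurrent N k x else 0)) ^ 2 ∂μw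
      ≤ C * ((L : ℝ) + 1) * Z := h
    _ ≤ max C 0 * ((L : ℝ) + 1) * Z :=
        mul_le_mul_of_nonneg_right (mul_le_mul_of_nonneg_right (le_max_left _ _) hL) hZpos.le
    _ = Z * (max C 0 * ((L : ℝ) + 1)) := by ring

/-! ### The absolute block Green–Kubo integral is at most linear -/

/-- **`∫₀ᵗ |K_J(s)| ds ≤ C_J (L+1) t`** (`t ≥ 0`) for the block-current autocorrelation `K_J(s) = ∫ J · P_s J dμ_T` of the pinned
anharmonic chain (`ω₂ > 0`, `lam ≥ 0`, `β, γ > 0`, `N ≥ 1`, `T > 0`): `|K_J(s)| ≤ ∫ J² dμ_T` (`pinnedChain_autocorr_abs_le`: Jensen for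
the Markov kernel and Gibbs invariance) and `pinnedChain_integral_sq_blockSum_le`.  This is the static SIZE of the block
Green–Kubo integral; any `o(t)` here is dynamics. [folklore] -/
theorem pinnedChain_blockGK_abs_le {ω₂ lam β γ : ℝ} (hω : 0 < ω₂) (hl : 0 ≤ lam) (hβ : 0 < β) (hγ : 0 < γ) {T : ℝ}
    (hT : 0 < T) :
    ∃ C : ℝ, 0 ≤ C ∧ ∀ (N : ℕ), 0 < N → ∀ (b₀ L : ℕ) (t : ℝ), 0 ≤ t →
      ∫ s in (0 : ℝ)..t,
        |∫ z, (∑ k : Fin N, (if b₀ ≤ k.val ∧ k.val ≤ b₀ + L then (pinnedChain ω₂ lam β γ).bondCurrent N k z else 0)) *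
            (∫ y, (∑ k : Fin N, (if b₀ ≤ k.val ∧ k.val ≤ b₀ + L then (pinnedChain ω₂ lam β γ).bondCurrent N k y else 0))
              ∂((pinnedChain ω₂ lam β γ).transitionKernel N T T s.toNNReal z))
          ∂((pinnedChain ω₂ lam β γ).gibbsMeasure N T)| ≤ C * ((L : ℝ) + 1) * t := by
  obtain ⟨C, hC0, hC⟩ := pinnedChain_integral_sq_blockSum_le hω hl hβ.le γ hT
  refine ⟨C, hC0, fun N hN b₀ L t ht => ?_⟩
  have hϑ := quarter_inv_temp_admissible hT
  -- pointwise: `|K_J(s)| ≤ ∫ J² dμ_T ≤ C (L+1)`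
  have hpt : ∀ s : ℝ,
      |∫ z, (∑ k : Fin N, (if b₀ ≤ k.val ∧ k.val ≤ b₀ + L then (pinnedChain ω₂ lam β γ).bondCurrent N k z else 0)) *
          (∫ y, (∑ k : Fin N, (if b₀ ≤ k.val ∧ k.val ≤ b₀ + L then (pinnedChain ω₂ lam β γ).bondCurrent N k y else 0))
            ∂((pinnedChain ω₂ lam β γ).transitionKernel N T T s.toNNReal z))
        ∂((pinnedChain ω₂ lam β γ).gibbsMeasure N T)| ≤ C * ((L : ℝ) + 1) := fun s =>
    (pinnedChain_autocorr_abs_le hω hl hβ hγ hN hT hϑ.1 hϑ.2 (continuous_blockSum b₀ L)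
      (abs_blockSum_le_exp hω hl hβ b₀ L hϑ.1) s.toNNReal).trans (hC N b₀ L)
  have hint := intervalIntegral.norm_integral_le_of_norm_le_const (a := (0 : ℝ)) (b := t)
    (f := fun s : ℝ =>
      |∫ z, (∑ k : Fin N, (if b₀ ≤ k.val ∧ k.val ≤ b₀ + L then (pinnedChain ω₂ lam β γ).bondCurrent N k z else 0)) *
          (∫ y, (∑ k : Fin N, (if b₀ ≤ k.val ∧ k.val ≤ b₀ + L then (pinnedChain ω₂ lam β γ).bondCurrent N k y else 0))
            ∂((pinnedChain ω₂ lam β γ).transitionKernel N T T s.toNNReal z))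
        ∂((pinnedChain ω₂ lam β γ).gibbsMeasure N T)|)
    (C := C * ((L : ℝ) + 1)) fun s _ => by
      rw [Real.norm_eq_abs, abs_abs]
      exact hpt s
  rw [sub_zero, abs_of_nonneg ht, Real.norm_eq_abs] at hint
  exact (le_abs_self _).trans hint

/-! ### The linear ceiling -/

/-- **`V_N(b₀,t) ≤ B·t`, uniformly in `N` and in the bond, whenever the tent fits.**  For the pinned anharmonic chain (all
parameters `> 0`) and `T > 0` there is `B` (`= 4C_J + 16c⁺`, statics only) such that for every `N`, every bond `b₀` and every
`t ≥ 1` with `b₀ + ⌊t⌋ + 1 < N` (room for a tent of length `⌊t⌋` to the right of the bond — inside the light cone this is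
`t ≲ N − b₀`): `V_N(b₀,t) = 2∫₀ᵗ(t−s)C_N(b₀,s) ds ≤ B·t`.  Proof: tent reduction `pinnedChain_bondHeatVar_le_blockGK` with
`L = ⌊t⌋`, the static size `∫₀ᵗ|K_J| ≤ C_J(L+1)t` (`pinnedChain_blockGK_abs_le`), and `t < L + 1 ≤ 2t`. [folklore] -/
theorem pinnedChain_bondHeatVar_le_linear {ω₂ lam β γ : ℝ} (hω : 0 < ω₂) (hl : 0 ≤ lam) (hβ : 0 < β) (hγ : 0 < γ)
    {T : ℝ} (hT : 0 < T) :
    ∃ B : ℝ, ∀ (N b₀ : ℕ) (t : ℝ), 1 ≤ t → ∀ (hfit : b₀ + ⌊t⌋₊ + 1 < N),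
      2 * ∫ s in (0 : ℝ)..t, (t - s) * ∫ z, (pinnedChain ω₂ lam β γ).bondCurrent N ⟨b₀, by omega⟩ z *
          (∫ y, (pinnedChain ω₂ lam β γ).bondCurrent N ⟨b₀, by omega⟩ y
            ∂((pinnedChain ω₂ lam β γ).transitionKernel N T T s.toNNReal z))
          ∂((pinnedChain ω₂ lam β γ).gibbsMeasure N T) ≤ B * t := by
  obtain ⟨c, hc⟩ := pinnedChain_bondHeatVar_le_blockGK hω hl hβ hγ hT
  obtain ⟨C, hC0, hC⟩ := pinnedChain_blockGK_abs_le hω hl hβ hγ hT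
  refine ⟨4 * C + 16 * max c 0, fun N b₀ t ht1 hfit => ?_⟩
  have ht0 : 0 ≤ t := by linarith
  set L : ℕ := ⌊t⌋₊ with hL
  have hN : 0 < N := by omega
  have hLle : (L : ℝ) ≤ t := Nat.floor_le ht0
  have hLlt : t < (L : ℝ) + 1 := Nat.lt_floor_add_one t
  have hL1 : (0 : ℝ) < (L : ℝ) + 1 := by positivity
  have key := hc N b₀ L hfit t ht0
  have hJ := hC N hN b₀ L t ht0
  have hc' : c * ((L : ℝ) + 1) ≤ max c 0 * ((L : ℝ) + 1) := mul_le_mul_of_nonneg_right (le_max_left _ _) hL1.le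
  -- block term: `(4t/(L+1)²) · C (L+1) t = 4 C t² /(L+1) ≤ 4 C t`
  have hblock : 4 * t / ((L : ℝ) + 1) ^ 2 * (C * ((L : ℝ) + 1) * t) ≤ 4 * C * t := by
    have h1 : 4 * t / ((L : ℝ) + 1) ^ 2 * (C * ((L : ℝ) + 1) * t) = 4 * C * t * (t / ((L : ℝ) + 1)) := by
      field_simp
    rw [h1]
    have h2 : t / ((L : ℝ) + 1) ≤ 1 := by rw [div_le_one hL1]; exact hLlt.le
    have h3 : 0 ≤ 4 * C * t := by positivity
    nlinarith
  -- static term: `8 c (L+1) ≤ 16 c⁺ t`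
  have hstat : 8 * (c * ((L : ℝ) + 1)) ≤ 16 * max c 0 * t := by
    have h2 : (L : ℝ) + 1 ≤ 2 * t := by linarith
    nlinarith [mul_le_mul_of_nonneg_left h2 (le_max_right c 0), hc']
  calc _ ≤ 4 * t / ((L : ℝ) + 1) ^ 2 * _ + 8 * (c * ((L : ℝ) + 1)) := key
    _ ≤ 4 * t / ((L : ℝ) + 1) ^ 2 * (C * ((L : ℝ) + 1) * t) + 8 * (c * ((L : ℝ) + 1)) := by
        have h4 : 0 ≤ 4 * t / ((L : ℝ) + 1) ^ 2 := by positivity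
        nlinarith [mul_le_mul_of_nonneg_left hJ h4]
    _ ≤ 4 * C * t + 16 * max c 0 * t := add_le_add hblock hstat
    _ = (4 * C + 16 * max c 0) * t := by ring

/-- **The `N`-uniform linear ceiling of (S_lc)'s functional on the light cone, in the item's spelling.**  For the pinned
anharmonic chain (all parameters `> 0`) and `T > 0`: `∃ B ∀ N ≥ 3 ∀ t ∈ [1, N/2], V_N(0,t) ≤ B·t` (`C`, `V` verbatim the `let`s
of `LightConeBondHeat` / `SubdiffusiveBondHeat`; bond `b = 0`, tent `L = ⌊t⌋ ≤ N/2` fits since `N/2 + 1 < N`).  The item asks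
for `A√t` on `[1, a·N]`: everything between `t` and `√t` is the (open) dynamical content. [folklore] -/
theorem lightCone_bondHeatVar_le_linear :
    ∀ ω₂ lam β γ : ℝ, 0 < ω₂ → 0 < lam → 0 < β → 0 < γ → ∀ T : ℝ, 0 < T →
      (let P := pinnedChain ω₂ lam β γ
       let C : ℕ → ℕ → ℝ → ℝ := fun N b s => if h : b < N then ∫ z, P.bondCurrent N ⟨b, h⟩ z *
         (∫ y, P.bondCurrent N ⟨b, h⟩ y ∂(P.transitionKernel N T T s.toNNReal z)) ∂(P.gibbsMeasure N T) else 0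
       let V : ℕ → ℕ → ℝ → ℝ := fun N b t => 2 * ∫ s in (0 : ℝ)..t, (t - s) * C N b s
       ∃ B : ℝ, ∀ N : ℕ, 3 ≤ N → ∀ t : ℝ, 1 ≤ t → t ≤ 1 / 2 * (N : ℝ) → V N 0 t ≤ B * t) := by
  intro ω₂ lam β γ hω hl hβ hγ T hT P C V
  obtain ⟨B, hB⟩ := pinnedChain_bondHeatVar_le_linear hω hl.le hβ hγ hT
  refine ⟨B, fun N hN t ht1 htN => ?_⟩
  have hN0 : 0 < N := by omega
  have ht0 : 0 ≤ t := by linarith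
  -- the tent of length `⌊t⌋` to the right of bond `0` fits: `⌊t⌋ + 1 ≤ N/2 + 1 < N`
  have hfit : 0 + ⌊t⌋₊ + 1 < N := by
    have h1 : (⌊t⌋₊ : ℝ) ≤ t := Nat.floor_le ht0
    have hN3 : (3 : ℝ) ≤ (N : ℝ) := by exact_mod_cast hN
    have h2 : (⌊t⌋₊ : ℝ) + 1 < (N : ℝ) := by linarith
    have h3 : ⌊t⌋₊ + 1 < N := by exact_mod_cast h2
    omega
  have key := hB N 0 t ht1 hfit
  simp only [V, C, dif_pos hN0]
  exact key

end Summit.AtomisticToContinuum.FouriersLaw.Theorems.LightConeBondHeat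

end
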